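import Summits.ABC.IUTFork.Joshi.TestATS4LowerBoundGenuineConverseWitness
import HarnessLib

/-!
# R-J census, row Y-21ℓ — the located converse over EVERY number field `F ≠ ℚ`: the data hypotheses of the window witness are inhabited
# over every `F` (not only `ℚ(ζ₄)`), so «Statement ∧ ¬Cor91111» has a pilot datum over every `F` with `[F : ℚ] > 1`

Proof-only companion of the abc-iut cell, branch E → R-J «Joshi Y-discharge census» (D-0079; rung LADDER-ABC:A2.RESCUE.J), to abc-iut-E-t59's
p464724 `TestATS4LowerBoundGenuineConverseWitness` (seat abc-iut-E-t50, gen 8 — the row's counted reader; rider R5 of the counted-read sheet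
HOME/plan/E/t50/audit/AUDIT-Y21l-p463394-p464724.md). **No side is taken** on [IUTchIII] Cor. 3.12 / [IUTchIV] Thm 1.10, on [J-III] Cor 9.11.1.1 /
[J-IV] Thm 6.10.1 (unrefereed arXiv preprints) or on any author; typed ≠ proved ≠ endorsed; instantiated ≠ endorsed; no definition, no `Prop` fact.

p464724 §1 `exists_statement_and_not_cor91111_of_one_lt_finrank` produces, for pilot data `X` over `F` with `[F : ℚ] > 1` whose bad places FILL the
fibres over a finite set `U` of odd primes unramified in `F` containing two distinct primes, exponent-shaped ideles with free positive `q`-depth and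
an adelic datum `A` reading the genuine volumes with `Statement ∧ ¬A.Cor91111`; its §2 inhabits these seven data hypotheses over `ℚ(ζ₄)` only.
* §1 **`exists_pilotData_window_hypotheses`** — over EVERY number field `F` the seven data hypotheses are inhabited: primes `p₁ < p₂` exceeding
  `|disc F| + 2` (hence odd and `∤ disc F`, i.e. unramified — Dedekind), `j_E := (p₁p₂)⁻¹` (so `ord_v(j_E) < 0` exactly at the places above `p₁p₂`),
  `S := V(F)_{p₁} ∪ V(F)_{p₂}` (bad mass one by construction), `l := 5`, `U := {p₁, p₂}`. [folklore]
* §2 **`exists_statement_and_not_cor91111_anyField`** — hence for EVERY number field `F` with `[F : ℚ] > 1` there is a pilot datum over `F` at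
  which, for EVERY Thm-3.11 context, some exponent-shaped ideles (non-zero, units off `S`, norms `≤ 1`) and some adelic Θ-values-locus datum
  reading the genuine `q`-volumes and hull volumes of abc-iut-c312-7's `settingPrVolSharp` satisfy **`Statement ∧ ¬A.Cor91111`** — p464724 §1
  composed with §1 here; the census word «REFUTED over every F ≠ ℚ» BY NAME.
HONEST SCOPE (verbatim the parent's): FREE `q`-depth (the ideles need NOT realise `P_q`); the Statement holds at the witness BY (Ind1)/(Ind2)-INFLATION
of the unit boxes at the ramified packets, «saying nothing about print's intended content» (abc-iut-w4-d107 part 12); a PilotData-level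
inhabitant only (no elliptic curve, no `K = F(E[l])`); vs S unchanged: S-BYPASSED (p447958). [claim: Joshi2024ATS3, status: disputed]
[claim: Mochizuki2012, status: disputed] for the items cited BY NAME; [cite: DupuyHilado2025, §3.3, §3.6, §3.9] (carriers);
[cite: NeukirchANT1999, Ch. III (2.12) Cor.] (ramified ⟺ divides the discriminant; (2.17) there is Minkowski's `|disc| > 1`).
Standard axioms. (Doc-only v2: citation number corrected per abc-iut-aud-10's RQ7 note; declarations byte-identical.)
-/

noncomputable section

open Set Function NumberField IsDedekindDomain Finset
open scoped Pointwise

namespace Summit.ABC.IUTFork.Joshi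

open Thm311 Thm311.Real Cor312 Cor312.Setting Cor312Vol Literature.IUT.LogThetaLattice Literature.IUT.LogVolume
  Literature.IUT.HodgeTheaters

namespace TestATS4LowerBound

/-! ## 1. The data hypotheses of the window witness are inhabited over EVERY number field -/

/-- **Over EVERY number field `F` there is a pilot datum whose bad places fill the fibres over two distinct odd primes unramified in `F`.**
Take primes `p₁ < p₂` exceeding `|disc F| + 2` — so `p ∤ disc F` (a divisor of the non-zero integer `disc F` is at most `|disc F|`) and
`p > 2` —, `j_E := (p₁p₂)⁻¹` (`ord_v(p₁p₂) = e_v > 0` at every `v ∣ p₁p₂`, [IUTchI] Cor 2.2-style bookkeeping `ord_natCast_eq_ramIdx`),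
`S := V(F)_{p₁} ∪ V(F)_{p₂}`, `l := 5`, `U := {p₁, p₂}`: then (hU) the primes under `S` lie in `U`, (hUS) every place above `U` lies in `S`,
(hU2) `U` is odd, (hUd) `U ∤ disc F`, and `p₁ ≠ p₂ ∈ U` — the seven data hypotheses of p464724 §1. [folklore]
[cite: DupuyHilado2025, §3.3] (pilot data) [cite: NeukirchANT1999, Ch. III (2.12) Cor.] -/
theorem exists_pilotData_window_hypotheses (F : Type) [Field F] [NumberField F] :
    ∃ (X : PilotData F) (U : Finset Nat.Primes) (p₁ p₂ : Nat.Primes),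
      (∀ (pp : Nat.Primes) (x : (thetaIndex X).Fibre (.inr pp)),
        haveI : Fact (pp : ℕ).Prime := ⟨pp.2⟩; placeOf X pp.1 x ∈ X.S → pp ∈ U) ∧
      (∀ (pp : Nat.Primes), pp ∈ U → ∀ (x : (thetaIndex X).Fibre (.inr pp)),
        haveI : Fact (pp : ℕ).Prime := ⟨pp.2⟩; placeOf X pp.1 x ∈ X.S) ∧
      (∀ pp ∈ U, 2 < (pp : ℕ)) ∧ (∀ pp ∈ U, ¬ ((pp : ℕ) : ℤ) ∣ NumberField.discr F) ∧
      p₁ ∈ U ∧ p₂ ∈ U ∧ p₁ ≠ p₂ := by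
  classical
  -- two distinct primes above `|disc F| + 2`
  obtain ⟨q₁, hq₁N, hq₁⟩ := Nat.exists_infinite_primes ((NumberField.discr F).natAbs + 3)
  obtain ⟨q₂, hq₂N, hq₂⟩ := Nat.exists_infinite_primes (q₁ + 1)
  have hq12 : q₁ ≠ q₂ := by omega
  haveI hf₁ : Fact q₁.Prime := ⟨hq₁⟩
  haveI hf₂ : Fact q₂.Prime := ⟨hq₂⟩
  have hnd : ∀ q : ℕ, (NumberField.discr F).natAbs + 3 ≤ q → ¬ ((q : ℕ) : ℤ) ∣ NumberField.discr F := by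
    intro q hq hdvd
    have hd0 : NumberField.discr F ≠ 0 := NumberField.discr_ne_zero F
    have h1 : q ∣ (NumberField.discr F).natAbs := Int.natCast_dvd.mp hdvd
    have h2 : q ≤ (NumberField.discr F).natAbs := Nat.le_of_dvd (Int.natAbs_pos.mpr hd0) h1
    omega
  -- `ord_v(p₁ p₂) > 0` at every place over `p₁` or `p₂`
  have hord_nonneg : ∀ (v : HeightOneSpectrum (𝓞 F)) (m : ℕ), 0 ≤ ord F v ((m : ℕ) : F) := fun v m => by
    have h := ord_nonneg_of_isIntegral F v ((m : ℕ) : 𝓞 F)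
    exact_mod_cast h
  have hordprod : ∀ v ∈ placesOver F q₁ ∪ placesOver F q₂, 0 < ord F v ((q₁ * q₂ : ℕ) : F) := by
    intro v hv
    have hq1ne : ((q₁ : ℕ) : F) ≠ 0 := by exact_mod_cast hq₁.ne_zero
    have hq2ne : ((q₂ : ℕ) : F) ≠ 0 := by exact_mod_cast hq₂.ne_zero
    rw [Nat.cast_mul, ord_mul F v hq1ne hq2ne]
    rcases Finset.mem_union.mp hv with hv1 | hv2
    · have he := Cor22.ord_natCast_eq_ramIdx q₁ v hv1
      have hpos : 0 < (ramIdx F v : ℤ) := by exact_mod_cast Nat.pos_of_ne_zero (ramIdx_ne_zero F v)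
      linarith [hord_nonneg v q₂]
    · have he := Cor22.ord_natCast_eq_ramIdx q₂ v hv2
      have hpos : 0 < (ramIdx F v : ℤ) := by exact_mod_cast Nat.pos_of_ne_zero (ramIdx_ne_zero F v)
      linarith [hord_nonneg v q₁]
  let X : PilotData F :=
    { jE := (((q₁ * q₂ : ℕ) : F))⁻¹
      S := placesOver F q₁ ∪ placesOver F q₂
      S_nonempty := (placesOver_nonempty F q₁).mono Finset.subset_union_left
      ord_jE_neg := fun v hv => by rw [ord_inv]; linarith [hordprod v hv]
      l := 5
      l_prime := by norm_num
      five_le_l := le_rfl }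
  refine ⟨X, {⟨q₁, hq₁⟩, ⟨q₂, hq₂⟩}, ⟨q₁, hq₁⟩, ⟨q₂, hq₂⟩, ?_, ?_, ?_, ?_, by simp, by simp, fun h => hq12 (congrArg Subtype.val h)⟩
  · intro pp x hx
    haveI : Fact (pp : ℕ).Prime := ⟨pp.2⟩
    have hres : residueChar F (placeOf X pp.1 x) = pp := (mem_placesOver_iff_residueChar _).mp (placeOf_mem X pp.1 x)
    have hx' : placeOf X pp.1 x ∈ placesOver F q₁ ∪ placesOver F q₂ := hx
    rcases Finset.mem_union.mp hx' with h | h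
    · have h1 : residueChar F (placeOf X pp.1 x) = q₁ := (mem_placesOver_iff_residueChar _).mp h
      have : pp = ⟨q₁, hq₁⟩ := Subtype.ext (hres.symm.trans h1)
      simp [this]
    · have h2 : residueChar F (placeOf X pp.1 x) = q₂ := (mem_placesOver_iff_residueChar _).mp h
      have : pp = ⟨q₂, hq₂⟩ := Subtype.ext (hres.symm.trans h2)
      simp [this]
  · intro pp hpp x
    haveI : Fact (pp : ℕ).Prime := ⟨pp.2⟩
    have hmem := placeOf_mem X pp.1 x
    show placeOf X pp.1 x ∈ placesOver F q₁ ∪ placesOver F q₂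
    rcases Finset.mem_insert.mp hpp with rfl | hpp'
    · exact Finset.mem_union_left _ hmem
    · rw [Finset.mem_singleton] at hpp'
      subst hpp'
      exact Finset.mem_union_right _ hmem
  · intro pp hpp
    rcases Finset.mem_insert.mp hpp with rfl | hpp'
    · show 2 < q₁; omega
    · rw [Finset.mem_singleton] at hpp'; subst hpp'; show 2 < q₂; omega
  · intro pp hpp
    rcases Finset.mem_insert.mp hpp with rfl | hpp'
    · exact hnd q₁ hq₁N
    · rw [Finset.mem_singleton] at hpp'; subst hpp'; exact hnd q₂ (by omega)

/-! ## 2. «REFUTED over every `F ≠ ℚ`», composed BY NAME -/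

/-- **THE LOCATED CONVERSE OF Y-21ℓ FAILS AT SOME PILOT DATUM OVER EVERY NUMBER FIELD `F ≠ ℚ`.** For every number field `F` with `[F : ℚ] > 1`
there are a pilot datum `X` over `F` and a finite set `s` of its tame rational places such that, for EVERY Thm-3.11 context (analytic logs,
containers, column, lattice, Frobenioid signature, splitting monoids, `q`-pilot data), there are exponent-shaped pilot ideles — non-zero, units
off `S`, of norm `≤ 1` everywhere, FREE positive `q`-depth (NOT required to realise `P_q`) — and an adelic Θ-values-locus datum `A` on `s`
READING the genuine `q`-volumes (hq) and hull volumes (hV) of abc-iut-c312-7's `settingPrVolSharp`, with **`Statement ∧ ¬ A.Cor91111`**: OUR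
typed [IUTchIII] Cor. 3.12 Statement holds (by (Ind1)/(Ind2)-inflation of unit boxes at the ramified packets — part 12's caveat) while Joshi's
[J-III] Cor 9.11.1.1 read through the dictionary fails. p464724 §1 at the pilot datum of §1 here. No side taken.
[claim: Joshi2024ATS3, status: disputed] [claim: Mochizuki2012, status: disputed] [cite: DupuyHilado2025, §3.6, §3.9, §4.7, §4.9] -/
theorem exists_statement_and_not_cor91111_anyField (F : Type) [Field F] [NumberField F] (hF : 1 < Module.finrank ℚ F) :
    ∃ (X : PilotData F) (s : Finset (thetaIndex X).VQ),
      ∀ {logv : PadicLogs F} (hlog : LogvAnalytic logv) (M : Type) [Field M] [NumberField M]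
        (archPk : ∀ (j : (thetaIndex X).Label) (vQ : (thetaIndex X).VQ), Set ((logShellsDH X logv).Packet j vQ))
        (archSub : ∀ (j : (thetaIndex X).Label) (v : (thetaIndex X).V),
          Set ((logShellsDH X logv).Packet j ((thetaIndex X).over v)))
        (Ψ : ℤ → ∀ v : (thetaIndex X).V, v ∈ (thetaIndex X).Vbad → Set ((logShellsDH X logv).StarPacket v))
        (act : ℤ → ∀ v : (thetaIndex X).V, v ∈ (thetaIndex X).Vbad →
          (logShellsDH X logv).StarPacket v → Module.End ℚ ((logShellsDH X logv).StarPacket v))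
        (Mmod : ℤ → ∀ j : (thetaIndex X).LabelStar, Set ((logShellsDH X logv).GlobalPacket j.1))
        (region : ℤ → ∀ j : (thetaIndex X).LabelStar, FinDivisor M → ∀ vQ : (thetaIndex X).VQ,
          Set ((logShellsDH X logv).Packet j.1 vQ))
        (n : ℤ) {HT : Type} {LogLink : HT → HT → Type} {IsFull : ∀ {s t : HT}, LogLink s t → Prop}
        (lat : LGPGaussianLogThetaLattice LogLink IsFull)
        {Frd : Type} {IsoF : Frd → Frd → Type} {Ob : Frd → Type} {realify : Frd → Frd} {Strip : Type}
        {IsoS : Strip → Strip → Type} {Mv : ∀ v : (thetaIndex X).V, v ∈ (thetaIndex X).Vbad → Type}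
        [∀ v h, Monoid (Mv v h)]
        (sig : GlobalLGPFrobenioidSignature (thetaIndex X).lstar (thetaIndex X).V (· ∈ (thetaIndex X).Vbad)
          Frd IsoF Ob realify Strip IsoS Mv)
        (split : SplittingMonoids Mv) {ObΔ : Type} {N : ∀ v : (thetaIndex X).V, v ∈ (thetaIndex X).Vbad → Type}
        [∀ v h, Monoid (N v h)] (qData : QPilotData ObΔ N),
      ∃ (tq : ∀ (pp : Nat.Primes) (x : (thetaIndex X).Fibre (.inr pp)), haveI : Fact (pp : ℕ).Prime := ⟨pp.2⟩; kOf X pp.1 x)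
        (t : ∀ (pp : Nat.Primes) (_ : Fin X.lstar) (x : (thetaIndex X).Fibre (.inr pp)),
          haveI : Fact (pp : ℕ).Prime := ⟨pp.2⟩; kOf X pp.1 x)
        (htq0 : ∀ pp x, tq pp x ≠ 0)
        (htq1 : ∀ (pp : Nat.Primes) (x : (thetaIndex X).Fibre (.inr pp)),
          haveI : Fact (pp : ℕ).Prime := ⟨pp.2⟩; placeOf X pp.1 x ∉ X.S → ‖tq pp x‖ = 1)
        (_ : ∀ pp i x, t pp i x ≠ 0)
        (_ : ∀ (pp : Nat.Primes) (i : Fin X.lstar) (x : (thetaIndex X).Fibre (.inr pp)),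
          haveI : Fact (pp : ℕ).Prime := ⟨pp.2⟩; placeOf X pp.1 x ∉ X.S → ‖t pp i x‖ = 1),
        (∀ pp i x, ‖t pp i x‖ ≤ 1) ∧ (∀ pp x, ‖tq pp x‖ ≤ 1) ∧
        ∃ A : ATS3.AdelicLocusDatum (thetaIndex X).lstar s,
          (∀ (i : Fin (thetaIndex X).lstar) (w : s), Real.log (A.loc w).qroot =
            (settingPrVolSharp X hlog M archPk archSub Ψ act Mmod region n lat sig split qData tq t htq0 htq1).qLocal
              (Setting.labelSucc i) w) ∧
          (∀ w : s, Real.log (A.loc w).hullVol =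
            ∑ i : Fin (thetaIndex X).lstar, ((situationPrVol X hlog M archPk archSub Ψ act Mmod region).D n).logvol
              (Setting.labelSucc i) w
              ((settingPrVolSharp X hlog M archPk archSub Ψ act Mmod region n lat sig split qData tq t htq0 htq1).thetaHull
                (Setting.labelSucc i) w)) ∧
          (settingPrVolSharp X hlog M archPk archSub Ψ act Mmod region n lat sig split qData tq t htq0 htq1).Statement ∧
          ¬ A.Cor91111 := by
  obtain ⟨X, U, p₁, p₂, hU, hUS, hU2, hUd, hp₁, hp₂, hne⟩ := exists_pilotData_window_hypotheses F
  refine ⟨X, U.map ⟨fun pp => (Sum.inr pp : (thetaIndex X).VQ), fun _ _ h => Sum.inr_injective h⟩, ?_⟩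
  intro logv hlog M _ _ archPk archSub Ψ act Mmod region n HT LogLink IsFull lat Frd IsoF Ob realify Strip IsoS Mv _ sig split ObΔ N _
    qData
  have hs : ∀ w, w ∈ U.map ⟨fun pp => (Sum.inr pp : (thetaIndex X).VQ), fun _ _ h => Sum.inr_injective h⟩ ↔
      ∃ pp ∈ U, w = Sum.inr pp := fun w => by
    simp only [Finset.mem_map, Function.Embedding.coeFn_mk]
    exact ⟨fun ⟨pp, hpp, h⟩ => ⟨pp, hpp, h.symm⟩, fun ⟨pp, hpp, h⟩ => ⟨pp, hpp, h.symm⟩⟩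
  exact exists_statement_and_not_cor91111_of_one_lt_finrank X hlog M archPk archSub Ψ act Mmod region n lat sig split qData U hU hUS hU2
    hUd _ hs hF hp₁ hp₂ hne

end TestATS4LowerBound

end Summit.ABC.IUTFork.Joshi

end
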